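import Literature.AnabelianGeometry.AbsoluteAnabelian.CuspidalizationFactsModel
import Literature.AnabelianGeometry.AbsoluteAnabelian.GaloisSectionsFactsSchemaNegative
import Literature.AnabelianGeometry.AbsoluteAnabelian.MLFGaloisTypeProofs
import Mathlib.Topology.Instances.ZMod
import HarnessLib

/-!
# [GalSect] Thm. 1.3 (ii) / [AbsCusp] Prop. 1.6 (iii), MODEL-RELATIVE forms (FACT-LIST F-0084 / F-0045):
# universal closures over ALL interfaces `M : CurveModel` REFUTED

Proof-only companion of `CuspidalizationFactsModel.lean` (abc-iut-L4 lineage, p406112; imported, never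
edited).  S. Mochizuki, *Galois sections in absolute anabelian geometry*, Nagoya Math. J. 179 (2005)
[GalSect], Thm. 1.3 (ii) p. 6; *Absolute anabelian cuspidalizations of proper hyperbolic curves*,
J. Math. Kyoto Univ. 47 (2007) [AbsCusp], Prop. 1.6 (iii) p. 15.  Cell abc-iut, block F (fact-proving
wave), seat abc-iut-f-094, FACT-LIST tranche 94.

Both rows are NAMED FACTS RELATIVE TO an interface `M : AbsTopIII.CurveModel` (typing policy θ, shape
(M): "for every curve of the model satisfying the printed hypotheses, the shape-(1) predicate holds for
the group data `M` assigns to it").  The shape-(1) predicates themselves (`GalSect.Thm_1_3_ii_points`,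
`GalSect.Thm_1_3_ii_cusps`, `AbsCusp.Prop_1_6_iii`; rows F-0104 / F-0103 / F-0050) were shown to be
SCHEMATA by sibling seats (`GaloisSectionsFactsThm13iiSchema`, `GaloisSectionsFactsSchemaNegative`,
`AbsCuspFactsSchemaRefutations`: universal closures refuted, degenerate instances such as
`AbsCusp.prop_1_6_iii_id_of_isEmpty` — `S = ∅`, `q = 𝟙` — proved).  This file does the same for the
(M)-forms: the interface records `M.decomp` (decomposition groups of closed points) and `M.res` (the
surjections `Π_U ↠ Π_{U'}`) as BARE DATA, tied to no geometry, so the universal closure of either row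
over ALL `M` is false, exactly as for F-0044 (`AbsCuspSeparatedProofs`):

* `exists_curveModel_decomp_bot_res_one` builds, for every prime `p`, WITNESS DATA (not a model of any
  curve): one "curve" `X` flagged proper and scheme-like over the MLF `ℚ_p`, extension
  `Π = G_{ℚ_p} × ℤ/2ℤ ↠ G_{ℚ_p}` (so `Π ≠ 1` whatever `G_{ℚ_p}` is), no cusps, ONE "closed point" with
  decomposition datum `D = 1`, and `IsCofiniteOpen X X` with `res` the TRIVIAL endomorphism `Π → 1`.
  There `D = 1` is not commensurably terminal (`C_Π(1) = Π ≠ 1`, sibling lemma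
  `GalSect.not_isCommensurablyTerminal_bot`) and `res` is not surjective.
* Hence `GalSect.not_forall_thm_1_3_ii_model` (**F-0084, universal closure REFUTED**) and
  `AbsCusp.not_forall_prop_1_6_iii_model` (**F-0045, universal closure REFUTED**), universe `0`.

Consequence of record: both rows are consumable only AT A NAMED MODEL `M` (hypotheses
`(h : GalSect.Thm_1_3_ii_model M hclosed)`, `(h : AbsCusp.Prop_1_6_iii_model M)`); no consumer exists in
the tree today (grep `lean/Literature lean/Summits`: declarations only), and no `CurveModel` instance
exists (the étale `π₁` is not constructed, plan/FOUNDATIONS.md row 12), so no instance form can be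
proved either; the printed content ([GalSect] Thm. 1.3 (ii): commensurable terminality of decomposition
groups — proof p. 6: "follows formally from assertion (i) and the definition of a decomposition group",
(i) itself "from [Mzk1], Theorem C" [erratum v2: v1 of this docstring wrote "via [Mzk2]", which p. 6
cites for (iii) only; audit aud-25 p428769]; [AbsCusp] Prop. 1.6 (iii): the structure of the maximal
cuspidally central quotient `Δ^{c-cn}_{U_S}`, statement p. 14 (last sentence) – p. 15, proof p. 15) is not
available from Mathlib and stays a named input.

HONEST FRAMING: statements about OUR typed interface, not about print's Thm. 1.3 (ii) / Prop. 1.6 (iii)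
(refuting a universal closure over junk interfaces ≠ refuting print); refereed results typed
statements-first (D-0014); typed ≠ proved; no model of any curve is asserted to exist; nothing here bears
on the disputed [IUTchIII] Cor. 3.12; no side taken.
-/

noncomputable section

open scoped Classical Pointwise

namespace Literature.AnabelianGeometry.AbsoluteAnabelian

open AbsTopIII CategoryTheory

/-! ### Witness data: one "curve" over `ℚ_p`, `Π = G_{ℚ_p} × ℤ/2ℤ`, a point with `D = 1`, `res = 1` -/

/-- **WITNESS DATA for F-0084 / F-0045** (not a model of any curve): for every prime `p` there is an
interface `M : CurveModel` with closed decomposition data and a "curve" `X`, flagged proper and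
scheme-like over the MLF `ℚ_p`, with no cusps, `IsCofiniteOpen X X`, such that (a) the [GalSect]
Thm. 1.3 (ii) predicate FAILS for its point data (the one "closed point" has `D = 1`, and
`C_Π(1) = Π ≠ 1` as `Π = G_{ℚ_p} × ℤ/2ℤ`; `GalSect.not_isCommensurablyTerminal_bot`), and (b) the [AbsCusp]
Prop. 1.6 (iii) predicate FAILS for `res : Π_X → Π_X` (the trivial endomorphism, not surjective).  `CurveModel` records `decomp` and `res` as bare data;
print concerns the étale `π₁`, which the tree does not construct.
[cite: MochizukiGalSect2005, Thm 1.3 (ii) p.6] -/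
theorem exists_curveModel_decomp_bot_res_one (p : ℕ) [Fact p.Prime] :
    ∃ (M : CurveModel.{0})
      (hclosed : ∀ (U : M.Curve) (x : M.Point U), IsClosed (M.decomp U x : Set (M.ext U).arith))
      (X : M.Curve) (hXX : M.IsCofiniteOpen X X),
      M.IsProper X ∧ M.IsScheme X ∧ IsMLF (M.base X) ∧ IsEmpty (M.cusps X).Cusp ∧
        ¬ GalSect.Thm_1_3_ii_points (GalSect.pointDataOf M X (hclosed X)) ∧
        ¬ AbsCusp.Prop_1_6_iii (M.res hXX)
            (fun c : (M.cusps X).Cusp => (M.cusps X).Icusp c) := by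
  have hP : Nontrivial (Multiplicative (ZMod 2)) :=
    ⟨⟨Multiplicative.ofAdd 0, Multiplicative.ofAdd 1,
      Multiplicative.ofAdd.injective.ne (by decide : (0 : ZMod 2) ≠ 1)⟩⟩
  let E₀ : FundamentalExtension.{0} :=
    ⟨ProfiniteGrp.of (Field.absoluteGaloisGroup ℚ_[p] × Multiplicative (ZMod 2)),
      absoluteGaloisGrp ℚ_[p], ContinuousMonoidHom.fst _ _, fun g => ⟨(g, 1), rfl⟩⟩
  haveI hE : Nontrivial E₀.arith :=
    inferInstanceAs (Nontrivial (Field.absoluteGaloisGroup ℚ_[p] × Multiplicative (ZMod 2)))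
  let C₀ : E₀.CuspidalData :=
    { Cusp := PEmpty
      Dcusp := fun c => c.elim
      Icusp := fun c => c.elim
      Icusp_eq := fun c => c.elim
      isClosed_Dcusp := fun c => c.elim
      eq_of_conj := fun c => c.elim }
  let q₀ : E₀ ⟶ E₀ := ⟨1, 1, fun x => by simp⟩
  let M : CurveModel.{0} :=
    { Curve := PUnit
      base := fun _ => ℚ_[p]
      ext := fun _ => E₀
      galIso := fun _ => Iso.refl _
      cusps := fun _ => C₀
      IsProper := fun _ => True
      IsScheme := fun _ => True
      genus := fun _ => 2
      FunctionField := fun _ => ℚ_[p]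
      Point := fun _ => PUnit
      decomp := fun _ _ => ⊥
      IsNFCurve := fun _ => False
      IsNFPoint := fun _ _ => False
      IsNFRational := fun _ _ => False
      IsNFConstant := fun _ _ => False
      NFFunctionField := fun _ => ℚ_[p]
      IsStrictlyBelyiType := fun _ => False
      IsCofiniteOpen := fun _ _ => True
      res := fun _ => q₀ }
  refine ⟨M, fun _ _ => ?_, PUnit.unit, trivial, trivial, trivial, isMLF_padic p,
    inferInstanceAs (IsEmpty PEmpty), fun h => ?_, fun h => ?_⟩
  · -- the decomposition datum `D = 1` is closed (`Π` is Hausdorff)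
    change IsClosed (((⊥ : Subgroup E₀.arith)) : Set E₀.arith)
    rw [Subgroup.coe_bot]
    exact isClosed_singleton
  · -- (a) `D = 1` is not commensurably terminal in `Π ≠ 1`
    exact GalSect.not_isCommensurablyTerminal_bot E₀.arith (h PUnit.unit)
  · -- (b) the trivial endomorphism `Π → 1 → Π` is not surjective
    have hq : ∀ b : E₀.arith, (M.res (U := PUnit.unit) (U' := PUnit.unit) trivial).arith b = 1 :=
      fun _ => rfl
    obtain ⟨x, hx⟩ := exists_ne (1 : E₀.arith)
    obtain ⟨a, ha⟩ := h.1 x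
    exact hx (ha.symm.trans (hq a))

/-! ### F-0084: the universal closure of `GalSect.Thm_1_3_ii_model` over ALL interfaces is false -/

namespace GalSect

/-- **FACT-LIST F-0084, universal closure REFUTED** (universe `0`): `Thm_1_3_ii_model M hclosed` fails
for the witness interface of `exists_curveModel_decomp_bot_res_one` (any prime, here `p = 2`): its one
"curve" lies over the MLF `ℚ_2` and carries a "closed point" whose decomposition datum `D = 1` is not
commensurably terminal.  So the row [GalSect] Thm. 1.3 (ii) (relative to `M`) is consumable only AT A
NAMED MODEL `M`, as a hypothesis `(h : Thm_1_3_ii_model M hclosed)`, never as its closure over all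
interfaces; this refutes OUR `∀ M`-reading of a shape-(M) schema, not print's Theorem 1.3 (ii).
[cite: MochizukiGalSect2005, Thm 1.3 (ii) p.6] -/
theorem not_forall_thm_1_3_ii_model :
    ¬ ∀ (M : CurveModel.{0})
        (hclosed : ∀ (U : M.Curve) (x : M.Point U), IsClosed (M.decomp U x : Set (M.ext U).arith)),
        Thm_1_3_ii_model M hclosed := by
  intro h
  haveI : Fact (Nat.Prime 2) := ⟨Nat.prime_two⟩
  obtain ⟨M, hclosed, X, -, -, -, hk, -, hX, -⟩ := exists_curveModel_decomp_bot_res_one 2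
  exact hX (h M hclosed X hk).1

end GalSect

/-! ### F-0045: the universal closure of `AbsCusp.Prop_1_6_iii_model` over ALL interfaces is false -/

namespace AbsCusp

/-- **FACT-LIST F-0045, universal closure REFUTED** (universe `0`): `Prop_1_6_iii_model M` fails for the
witness interface of `exists_curveModel_decomp_bot_res_one` (any prime, here `p = 2`): its one "curve"
`X = U_S` is flagged proper over the MLF `ℚ_2`, has no cusps (so "all cusps are rational" holds
vacuously), `IsCofiniteOpen X X` holds, and `M.res` is the trivial endomorphism `Π → 1`, which is not
surjective — the first clause of `Prop_1_6_iii` (whereas at `q = 𝟙`, `S = ∅` the predicate HOLDS: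
sibling lemma `AbsCusp.prop_1_6_iii_id_of_isEmpty`, the printed proposition's trivial case `U_S = X`).
So the row [AbsCusp] Prop. 1.6 (iii) (relative to `M`) is consumable only AT A NAMED MODEL `M`, as a
hypothesis `(h : Prop_1_6_iii_model M)`, never as its closure over all interfaces; this refutes OUR
`∀ M`-reading of a shape-(M) schema, not print's Proposition 1.6 (iii).
[cite: MochizukiAbsCusp2007, Prop 1.6 (iii) p.15] -/
theorem not_forall_prop_1_6_iii_model : ¬ ∀ M : CurveModel.{0}, Prop_1_6_iii_model M := by
  intro h
  haveI : Fact (Nat.Prime 2) := ⟨Nat.prime_two⟩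
  obtain ⟨M, -, X, hXX, hP, -, hk, hS, -, hX⟩ := exists_curveModel_decomp_bot_res_one 2
  haveI := hS
  exact hX (h M X X hXX hP hk fun c => isEmptyElim c)

end AbsCusp

end Literature.AnabelianGeometry.AbsoluteAnabelian

end
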